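import Mathlib
import Summits.ResolutionOfSingularities.ResolutionOfSingularities.Theorems.WildQuotientsWildQuotientResolutionToricExitRootChartPresentation
import Summits.ResolutionOfSingularities.ResolutionOfSingularities.Theorems.WildQuotientsWildQuotientResolutionToricExitRootSubstInjective

/-!
# Programme V4U (J₄ toric exit): the two SINGULAR vertex charts of `Bl_{I₆} 𝔸ⁿ` as invariant subrings of root charts

(crux stmt-ResolutionOfSingularities-15640 `WildQuotients.WildQuotientResolution`, line `Sketch`,
sector `|G| = p`; programme V4U of `L/w45c/CHAIN.md` v5 §NEXT (weights `(3,2,1)`, `J₄` =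
`JordanBlockFourfold` 17942); [OURS · L1 W4.5c] — NOT a statement of any manuscript.)

`I₆ = (x_a², x_a x_b², x_a x_b x_c, x_a x_c³, x_b³, x_b²x_c², x_b x_c⁴, x_c⁶)` (vector literal below,
charts `0 = D₊(x_a² t)`, `4 = D₊(x_b³ t)`, `7 = D₊(x_c⁶ t)` smooth — `JordanFour.isRegularRing_chartRing_I6_c`).
The two singular vertex charts are cyclic quotient singularities; this file presents their chart
rings as explicit subalgebras of a polynomial ROOT CHART (ring halves; the equivariant halves and the
exits are lead-1's / CHAIN v6's):

* `chart4_ringEquiv_adjoin` — `D₊(x_b³ t)` (`½(1,1,1)`): with `x_b = β²`, `x_a = A β³`, `x_c = C β`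
  (re-using the variables: `β = X b`, `A = X a`, `C = X c`) the chart ring `k[x][I₆/x_b³]` is the
  subalgebra generated by `Aβ³, β², Cβ, passengers` and the quotients `A², Aβ, AC, AC³, 1, C², C⁴, C⁶`
  = the EVEN (Veronese) subring of `k[A, β, C, …]`;
* `chart0_ringEquiv_adjoin` — `D₊(x_a² t)` (`⅓(1,1,2)`): with `x_a = α³`, `x_b = B α²`, `x_c = C α`
  the chart ring is generated by `α³, Bα², Cα, passengers` and `1, AB²→αB²…` precisely the quotients
  `1, A B², B C, C³, B³, B²C², B C⁴, C⁶` (in the re-used variables) = the `μ₃`-invariants of weight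
  `(1,1,2)`.
Both are instances of `ToricExit.nonempty_chartRing_ringEquiv_adjoin_of_rootData` (p489374) with
`ToricExit.monomialTwist_injective` (p489384).
-/

-- single-problem summit: the doubled namespace component `ResolutionOfSingularities` is forced
set_option linter.dupNamespace false

noncomputable section

open MvPolynomial Literature.AlgebraicGeometry.Resolution

namespace Summit.ResolutionOfSingularities.ResolutionOfSingularities.Theorems.WildQuotientResolution.JordanFour

/-- **The `μ₂` chart `D₊(x_b³ t)` of `Bl_{I₆} 𝔸ⁿ` as the Veronese subring of its root chart**:
root substitution `x_b ↦ β²`, `x_a ↦ x_a β³`, `x_c ↦ x_c β` (injective), `ψ₀(x_b³) = (x_b³)²`, and the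
eight chart generators `c_j/x_b³` become `x_a², x_a x_b, x_a x_c, x_a x_c³, 1, x_c², x_c⁴, x_c⁶`.
[OURS · L1 W4.5c] [folklore] -/
theorem chart4_ringEquiv_adjoin (k : Type) [Field k] (n : ℕ) (a b c : Fin n)
    (hab : a ≠ b) (hbc : b ≠ c) (hac : a ≠ c) :
    ∃ e : chartRing
        (![X a ^ 2, X a * X b ^ 2, X a * X b * X c, X a * X c ^ 3, X b ^ 3, X b ^ 2 * X c ^ 2,
            X b * X c ^ 4, X c ^ 6] : Fin 8 → MvPolynomial (Fin n) k) 4 ≃+*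
        ↥(Algebra.adjoin k
          (Set.range (fun s : Fin n => MvPolynomial.aeval
              (fun s : Fin n => (if s = b then X b ^ 2 else
                X s * X b ^ (if s = a then 3 else if s = c then 1 else 0) : MvPolynomial (Fin n) k))
              (X s : MvPolynomial (Fin n) k)) ∪
            Set.range (![X a ^ 2, X a * X b, X a * X c, X a * X c ^ 3, 1, X c ^ 2, X c ^ 4, X c ^ 6] :
              Fin 8 → MvPolynomial (Fin n) k))),
      (∀ f : MvPolynomial (Fin n) k,
        (e (chartBase
            (![X a ^ 2, X a * X b ^ 2, X a * X b * X c, X a * X c ^ 3, X b ^ 3, X b ^ 2 * X c ^ 2,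
                X b * X c ^ 4, X c ^ 6] : Fin 8 → MvPolynomial (Fin n) k) 4 f) :
            MvPolynomial (Fin n) k) =
          MvPolynomial.aeval
            (fun s : Fin n => (if s = b then X b ^ 2 else
              X s * X b ^ (if s = a then 3 else if s = c then 1 else 0) : MvPolynomial (Fin n) k)) f) ∧
      ∀ j : Fin 8,
        (e (chartGen
            (![X a ^ 2, X a * X b ^ 2, X a * X b * X c, X a * X c ^ 3, X b ^ 3, X b ^ 2 * X c ^ 2,
                X b * X c ^ 4, X c ^ 6] : Fin 8 → MvPolynomial (Fin n) k) 4 j) :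
            MvPolynomial (Fin n) k) =
          (![X a ^ 2, X a * X b, X a * X c, X a * X c ^ 3, 1, X c ^ 2, X c ^ 4, X c ^ 6] :
            Fin 8 → MvPolynomial (Fin n) k) j := by
  classical
  set g : Fin 8 → MvPolynomial (Fin n) k :=
    ![X a ^ 2, X a * X b ^ 2, X a * X b * X c, X a * X c ^ 3, X b ^ 3, X b ^ 2 * X c ^ 2,
      X b * X c ^ 4, X c ^ 6] with hg
  set q : Fin 8 → MvPolynomial (Fin n) k :=
    ![X a ^ 2, X a * X b, X a * X c, X a * X c ^ 3, 1, X c ^ 2, X c ^ 4, X c ^ 6] with hqdef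
  have hba : b ≠ a := fun h => hab h.symm
  have hca : c ≠ a := fun h => hac h.symm
  have hcb : c ≠ b := fun h => hbc h.symm
  let ψ₀ : MvPolynomial (Fin n) k →ₐ[k] MvPolynomial (Fin n) k :=
    aeval fun s : Fin n => (if s = b then X b ^ 2 else
      X s * X b ^ (if s = a then 3 else if s = c then 1 else 0) : MvPolynomial (Fin n) k)
  have hψa : ψ₀ (X a) = X a * X b ^ 3 := by simp [ψ₀, hab]
  have hψb : ψ₀ (X b) = X b ^ 2 := by simp [ψ₀]
  have hψc : ψ₀ (X c) = X c * X b ^ 1 := by simp [ψ₀, hcb, hca]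
  have hinj : Function.Injective ψ₀ :=
    ToricExit.monomialTwist_injective k n b 2 two_pos
      (fun s => if s = a then 3 else if s = c then 1 else 0)
  have hg4 : g 4 = X b ^ 3 := rfl
  have hunit : ψ₀ (g 4) * 1 = g 4 ^ 2 := by rw [hg4, map_pow, hψb]; ring
  have hq : ∀ j, ψ₀ (g j) = q j * ψ₀ (g 4) := by
    intro j
    rw [hg4, map_pow, hψb]
    fin_cases j
    · change ψ₀ (X a ^ 2) = X a ^ 2 * _
      rw [map_pow, hψa]; ring
    · change ψ₀ (X a * X b ^ 2) = X a * X b * _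
      rw [map_mul, map_pow, hψa, hψb]; ring
    · change ψ₀ (X a * X b * X c) = X a * X c * _
      rw [map_mul, map_mul, hψa, hψb, hψc]; ring
    · change ψ₀ (X a * X c ^ 3) = X a * X c ^ 3 * _
      rw [map_mul, map_pow, hψa, hψc]; ring
    · change ψ₀ (X b ^ 3) = 1 * _
      rw [map_pow, hψb]; ring
    · change ψ₀ (X b ^ 2 * X c ^ 2) = X c ^ 2 * _
      rw [map_mul, map_pow, map_pow, hψb, hψc]; ring
    · change ψ₀ (X b * X c ^ 4) = X c ^ 4 * _
      rw [map_mul, map_pow, hψb, hψc]; ring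
    · change ψ₀ (X c ^ 6) = X c ^ 6 * _
      rw [map_pow, hψc]; ring
  exact ToricExit.nonempty_chartRing_ringEquiv_adjoin_of_rootData k g 4
    (by rw [hg4]; exact pow_ne_zero _ (X_ne_zero b)) ψ₀ hinj 1 2 hunit q hq

/-- **The `μ₃` chart `D₊(x_a² t)` of `Bl_{I₆} 𝔸ⁿ` as the weight-`(1,1,2)` invariant subring of its
root chart**: root substitution `x_a ↦ α³`, `x_b ↦ x_b α²`, `x_c ↦ x_c α` (injective),
`ψ₀(x_a²) = (x_a²)³`, and the chart generators `c_j/x_a²` become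
`1, x_a x_b², x_b x_c, x_c³, x_b³, x_b² x_c², x_b x_c⁴, x_c⁶`. [OURS · L1 W4.5c] [folklore] -/
theorem chart0_ringEquiv_adjoin (k : Type) [Field k] (n : ℕ) (a b c : Fin n)
    (hab : a ≠ b) (hbc : b ≠ c) (hac : a ≠ c) :
    ∃ e : chartRing
        (![X a ^ 2, X a * X b ^ 2, X a * X b * X c, X a * X c ^ 3, X b ^ 3, X b ^ 2 * X c ^ 2,
            X b * X c ^ 4, X c ^ 6] : Fin 8 → MvPolynomial (Fin n) k) 0 ≃+*
        ↥(Algebra.adjoin k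
          (Set.range (fun s : Fin n => MvPolynomial.aeval
              (fun s : Fin n => (if s = a then X a ^ 3 else
                X s * X a ^ (if s = b then 2 else if s = c then 1 else 0) : MvPolynomial (Fin n) k))
              (X s : MvPolynomial (Fin n) k)) ∪
            Set.range (![1, X a * X b ^ 2, X b * X c, X c ^ 3, X b ^ 3, X b ^ 2 * X c ^ 2,
                X b * X c ^ 4, X c ^ 6] : Fin 8 → MvPolynomial (Fin n) k))),
      (∀ f : MvPolynomial (Fin n) k,
        (e (chartBase
            (![X a ^ 2, X a * X b ^ 2, X a * X b * X c, X a * X c ^ 3, X b ^ 3, X b ^ 2 * X c ^ 2,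
                X b * X c ^ 4, X c ^ 6] : Fin 8 → MvPolynomial (Fin n) k) 0 f) :
            MvPolynomial (Fin n) k) =
          MvPolynomial.aeval
            (fun s : Fin n => (if s = a then X a ^ 3 else
              X s * X a ^ (if s = b then 2 else if s = c then 1 else 0) : MvPolynomial (Fin n) k)) f) ∧
      ∀ j : Fin 8,
        (e (chartGen
            (![X a ^ 2, X a * X b ^ 2, X a * X b * X c, X a * X c ^ 3, X b ^ 3, X b ^ 2 * X c ^ 2,
                X b * X c ^ 4, X c ^ 6] : Fin 8 → MvPolynomial (Fin n) k) 0 j) :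
            MvPolynomial (Fin n) k) =
          (![1, X a * X b ^ 2, X b * X c, X c ^ 3, X b ^ 3, X b ^ 2 * X c ^ 2, X b * X c ^ 4, X c ^ 6] :
            Fin 8 → MvPolynomial (Fin n) k) j := by
  classical
  set g : Fin 8 → MvPolynomial (Fin n) k :=
    ![X a ^ 2, X a * X b ^ 2, X a * X b * X c, X a * X c ^ 3, X b ^ 3, X b ^ 2 * X c ^ 2,
      X b * X c ^ 4, X c ^ 6] with hg
  set q : Fin 8 → MvPolynomial (Fin n) k :=
    ![1, X a * X b ^ 2, X b * X c, X c ^ 3, X b ^ 3, X b ^ 2 * X c ^ 2, X b * X c ^ 4, X c ^ 6]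
    with hqdef
  have hba : b ≠ a := fun h => hab h.symm
  have hca : c ≠ a := fun h => hac h.symm
  have hcb : c ≠ b := fun h => hbc h.symm
  let ψ₀ : MvPolynomial (Fin n) k →ₐ[k] MvPolynomial (Fin n) k :=
    aeval fun s : Fin n => (if s = a then X a ^ 3 else
      X s * X a ^ (if s = b then 2 else if s = c then 1 else 0) : MvPolynomial (Fin n) k)
  have hψa : ψ₀ (X a) = X a ^ 3 := by simp [ψ₀]
  have hψb : ψ₀ (X b) = X b * X a ^ 2 := by simp [ψ₀, hba]
  have hψc : ψ₀ (X c) = X c * X a ^ 1 := by simp [ψ₀, hca, hcb]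
  have hinj : Function.Injective ψ₀ :=
    ToricExit.monomialTwist_injective k n a 3 (by norm_num)
      (fun s => if s = b then 2 else if s = c then 1 else 0)
  have hg0 : g 0 = X a ^ 2 := rfl
  have hunit : ψ₀ (g 0) * 1 = g 0 ^ 3 := by rw [hg0, map_pow, hψa]; ring
  have hq : ∀ j, ψ₀ (g j) = q j * ψ₀ (g 0) := by
    intro j
    rw [hg0, map_pow, hψa]
    fin_cases j
    · change ψ₀ (X a ^ 2) = 1 * _
      rw [map_pow, hψa]; ring
    · change ψ₀ (X a * X b ^ 2) = X a * X b ^ 2 * _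
      rw [map_mul, map_pow, hψa, hψb]; ring
    · change ψ₀ (X a * X b * X c) = X b * X c * _
      rw [map_mul, map_mul, hψa, hψb, hψc]; ring
    · change ψ₀ (X a * X c ^ 3) = X c ^ 3 * _
      rw [map_mul, map_pow, hψa, hψc]; ring
    · change ψ₀ (X b ^ 3) = X b ^ 3 * _
      rw [map_pow, hψb]; ring
    · change ψ₀ (X b ^ 2 * X c ^ 2) = X b ^ 2 * X c ^ 2 * _
      rw [map_mul, map_pow, map_pow, hψb, hψc]; ring
    · change ψ₀ (X b * X c ^ 4) = X b * X c ^ 4 * _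
      rw [map_mul, map_pow, hψb, hψc]; ring
    · change ψ₀ (X c ^ 6) = X c ^ 6 * _
      rw [map_pow, hψc]; ring
  exact ToricExit.nonempty_chartRing_ringEquiv_adjoin_of_rootData k g 0
    (by rw [hg0]; exact pow_ne_zero _ (X_ne_zero a)) ψ₀ hinj 1 3 hunit q hq

end Summit.ResolutionOfSingularities.ResolutionOfSingularities.Theorems.WildQuotientResolution.JordanFour

end
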